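/-
Copyright (c) 2026 the pub-hodgecm-mathlib formalisation cell (harness21).  Prover seat hodgecm-mathlib-K2E3-p23 (g3), Track B «K2-LIT» ∕ h413
(`stmt-HodgeConjecture-24833`), line `K2_E3_EllipticInputs`, 13a road A (line lead K2E3-p10 (g3)), item (D2) sequel F4 «kernel normalisation, any m».
2026-09-04.
-/
import Summits.HodgeConjecture.HodgeConjecture.Theorems.K2E3WittIwasawa                    -- F3 (this seat): `exists_wittParabolic_mul_mem_unitaryInt` (hGC for normalised kernels)
import Literature.NumberTheory.Automorphic.HermitianLatticesAnisotropicKernelNormalised       -- ★ p856519: `exists_formCongr_maximalLattice_eq_stdLattice`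
import Literature.NumberTheory.Automorphic.UnitaryGroupFormTransport                          -- ★ `formCongr`, `GLn.conjEquiv`, `conj_mem_unitaryGroupOfForm_iff`
import HarnessLib

/-!
# Crux `H413` — K2-LIT E3 «EllipticInputs», 13a road A, item (D2) sequel F4: KERNEL NORMALISATION FOR ANY `m` — a block-diagonal change of the anisotropic
# kernel `Han ↦ σ(g)ᵀ Han g` is a congruence of the Witt form, `U(σ, W(Han)) ≃ₜ* U(σ, W(σ(g)ᵀ Han g))`, and every Witt model may be given a NORMALISED
# kernel (integral, maximal lattice `𝒪^m`), whereupon ★ F3 supplies `U = P_S · K₀` with `K₀ = U ∩ GL_N(𝒪)`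

Cell `hodgecm-mathlib`, Track B «K2-LIT», crux item `stmt-HodgeConjecture-24833` (h413), socket U12-g ‹13a› road A.  The `m`-general twin of ★ p856319 §2
`K2E3LocalCarrierWittTransport.exists_wittKernel_normalised` (`m ≤ 1`: kernel `(h) ↦ (1)`).  For the `m = 2` places of `U_N(H)(L⁺_v)` the 13a driver is assembled
in the field model `U(σ, wittFormOn e Han)(L_w)`; this file lets that assembly ASSUME the kernel normalised in the sense of ★
`HermitianLattice.exists_formCongr_maximalLattice_eq_stdLattice` (p856519), which is the hypothesis `hHan hint hmax` of ★ F3 `K2E3WittIwasawa`.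

* §1 `kernelBlock_mul` — `diag(1_r, g, 1_r) · diag(1_r, g′, 1_r) = diag(1_r, g g′, 1_r)` on the Witt index type; `formCongr_kernelBlock_wittForm` —
  `σ(diag(1,g,1))ᵀ · W(r, Han) · diag(1,g,1) = W(r, σ(g)ᵀ Han g)` (block algebra); **`exists_GL_formCongr_wittFormOn_eq`** — on a carrier `n` along `e` there is
  `T ∈ GL_n` with `formCongr σ T (wittFormOn e Han) = wittFormOn e (formCongr σ g Han)`.
* §2 **`nonempty_continuousMulEquiv_wittFormOn_kernelCongr`** — `U(σ, wittFormOn e Han) ≃ₜ* U(σ, wittFormOn e (formCongr σ g Han))` (★ `GLn.conjEquiv` ∕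
  `conj_mem_unitaryGroupOfForm_iff`).
* §3 **`exists_wittKernel_maximalLattice_normalised`** — for `σ` an involution preserving `v`, a uniformiser `ϖ`, (norm) `hnorm` (unramified and tamely ramified
  places) and `[CompactSpace 𝒪[K]] [IsPrincipalIdealRing 𝒪[K]]`: every `σ`-hermitian anisotropic kernel `Han` (any `m`) has a normalised replacement `Han′` —
  hermitian, anisotropic, `∀ u u′, |Han′ u u′| ≤ 1`, `|h′(z,z)| ≤ 1 → z ∈ 𝒪^m` — with `U(σ, wittFormOn e Han) ≃ₜ* U(σ, wittFormOn e Han′)`; and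
  **`exists_wittKernel_normalised_hGC`** — the same `Han′` together with ★ F3's Iwasawa decomposition `U(σ, wittFormOn e Han′) = P_S · K₀` for every `S`.

`--supports stmt-HodgeConjecture-24833 --as helper`.  THEOREMS ONLY — no `def`, no named fact, no instance, no notation, no `sorry`.  HONEST LABEL: HC_CM is
proved only modulo the 7 printed citations (2 remaining named inputs: hLiu418 = stmt-HodgeConjecture-24832, h413 = stmt-HodgeConjecture-24833) until rung 0
closes; unconditional local algebra, closes no organ by itself.

References: [Dieudonne1971GroupesClassiques] J. Dieudonné, *La géométrie des groupes classiques* (1971), Chap. I §11 · [PlatonovRapinchuk1994] V. Platonov,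
A. Rapinchuk, *Algebraic Groups and Number Theory* (1994), §2.3 · [Omeara1963] O. T. O'Meara, *Introduction to Quadratic Forms* (1963), §91A Thm. 91:1 ·
[Jacobowitz1962] R. Jacobowitz, Amer. J. Math. 84 (1962), §4 · [BruhatTits1972] F. Bruhat, J. Tits, Publ. Math. IHÉS 41 (1972), (4.4.3).
-/

set_option autoImplicit false
-- the mandated namespace repeats `HodgeConjecture.HodgeConjecture`, as in every `Theorems/*.lean` of this sub-problem
set_option linter.dupNamespace false

noncomputable section

open scoped Matrix MatrixGroups Valued WithZero
open Matrix

namespace Summit.HodgeConjecture.HodgeConjecture.Cruxes.H413.K2E3WittKernelCongrTransport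

open Literature.NumberTheory.Automorphic Literature.NumberTheory.Automorphic.UnitaryGroup Literature.NumberTheory.Automorphic.HermitianLattice
open K2E3LocalUnitaryWitt K2E3WittIwasawa

/-! ## §1 The block-diagonal kernel change `diag(1_r, g, 1_r)` is a congruence `W(Han) ↦ W(σ(g)ᵀ Han g)` -/

section Block

variable {R : Type*} [CommRing R] (σ : R →+* R) {r m : ℕ}

/-- `diag(1_r, g, 1_r) · diag(1_r, g′, 1_r) = diag(1_r, g g′, 1_r)` on `WittIndex r m = Fin r ⊕ (Fin m ⊕ Fin r)`. [cite: Dieudonne1971GroupesClassiques, Chap. I §11] -/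
theorem kernelBlock_mul (g g' : Matrix (Fin m) (Fin m) R) :
    Matrix.fromBlocks (1 : Matrix (Fin r) (Fin r) R) 0 0 (Matrix.fromBlocks g 0 0 (1 : Matrix (Fin r) (Fin r) R)) *
        Matrix.fromBlocks (1 : Matrix (Fin r) (Fin r) R) 0 0 (Matrix.fromBlocks g' 0 0 (1 : Matrix (Fin r) (Fin r) R)) =
      Matrix.fromBlocks (1 : Matrix (Fin r) (Fin r) R) 0 0 (Matrix.fromBlocks (g * g') 0 0 (1 : Matrix (Fin r) (Fin r) R)) := by
  rw [Matrix.fromBlocks_multiply, Matrix.fromBlocks_multiply]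
  simp

/-- `diag(1_r, 1_m, 1_r) = 1`. [cite: Dieudonne1971GroupesClassiques, Chap. I §11] -/
theorem kernelBlock_one :
    Matrix.fromBlocks (1 : Matrix (Fin r) (Fin r) R) 0 0 (Matrix.fromBlocks (1 : Matrix (Fin m) (Fin m) R) 0 0 (1 : Matrix (Fin r) (Fin r) R)) = 1 := by
  rw [Matrix.fromBlocks_one, Matrix.fromBlocks_one]

/-- `σ` applied entrywise to `diag(1_r, g, 1_r)` is `diag(1_r, σ(g), 1_r)`. [cite: Dieudonne1971GroupesClassiques, Chap. I §11] -/
theorem kernelBlock_map (g : Matrix (Fin m) (Fin m) R) :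
    (Matrix.fromBlocks (1 : Matrix (Fin r) (Fin r) R) 0 0 (Matrix.fromBlocks g 0 0 (1 : Matrix (Fin r) (Fin r) R))).map σ =
      Matrix.fromBlocks (1 : Matrix (Fin r) (Fin r) R) 0 0 (Matrix.fromBlocks (g.map σ) 0 0 (1 : Matrix (Fin r) (Fin r) R)) := by
  simp only [Matrix.fromBlocks_map, Matrix.map_one σ (map_zero σ) (map_one σ), Matrix.map_zero σ (map_zero σ)]

/-- **The block-diagonal kernel change is a congruence of Witt forms**: `σ(diag(1,g,1))ᵀ · W(r, Han) · diag(1,g,1) = W(r, σ(g)ᵀ Han g)` — the pairing blocks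
are untouched, the kernel block is conjugated. [cite: Dieudonne1971GroupesClassiques, Chap. I §11] -/
theorem formCongr_kernelBlock_wittForm (g : Matrix (Fin m) (Fin m) R) (Han : Matrix (Fin m) (Fin m) R) :
    ((Matrix.fromBlocks (1 : Matrix (Fin r) (Fin r) R) 0 0 (Matrix.fromBlocks g 0 0 (1 : Matrix (Fin r) (Fin r) R))).map σ)ᵀ * wittForm r Han *
        Matrix.fromBlocks (1 : Matrix (Fin r) (Fin r) R) 0 0 (Matrix.fromBlocks g 0 0 (1 : Matrix (Fin r) (Fin r) R)) =
      wittForm r ((g.map σ)ᵀ * Han * g) := by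
  rw [kernelBlock_map, Matrix.fromBlocks_transpose, Matrix.fromBlocks_transpose]
  simp only [Matrix.transpose_one, Matrix.transpose_zero]
  rw [wittForm, wittForm, Matrix.fromBlocks_multiply, Matrix.fromBlocks_multiply]
  simp only [Matrix.one_mul, Matrix.zero_mul, Matrix.mul_zero, Matrix.mul_one, add_zero, zero_add, Matrix.fromCols_mul_fromBlocks,
    Matrix.fromBlocks_mul_fromRows, Matrix.fromBlocks_multiply]

end Block

/-! ## §1b On a carrier: `T = reindex e e (diag(1_r, g, 1_r)) ∈ GL_n` with `formCongr σ T (wittFormOn e Han) = wittFormOn e (formCongr σ g Han)` -/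

section Carrier

variable {R : Type*} [CommRing R] (σ : R →+* R) {r m : ℕ} {n : Type*} [Fintype n] [DecidableEq n] (e : WittIndex r m ≃ n)

/-- **The kernel change on a carrier.**  For `g ∈ GL_m(R)` there is `T ∈ GL_n(R)` — namely `reindex e e (diag(1_r, g, 1_r))`, inverse `reindex e e (diag(1_r, g⁻¹, 1_r))` —
with `formCongr σ T (wittFormOn e Han) = wittFormOn e (formCongr σ g Han)`. [cite: Dieudonne1971GroupesClassiques, Chap. I §11] [cite: PlatonovRapinchuk1994, §2.3] -/
theorem exists_GL_formCongr_wittFormOn_eq (g : GL (Fin m) R) (Han : Matrix (Fin m) (Fin m) R) :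
    ∃ T : GL n R, (T : Matrix n n R) = Matrix.reindex e e (Matrix.fromBlocks (1 : Matrix (Fin r) (Fin r) R) 0 0 (Matrix.fromBlocks (g : Matrix (Fin m) (Fin m) R) 0 0 1)) ∧
      formCongr σ T (wittFormOn e Han) = wittFormOn e (formCongr σ g Han) := by
  have hmul : ∀ a b : Matrix (Fin m) (Fin m) R,
      Matrix.reindex e e (Matrix.fromBlocks (1 : Matrix (Fin r) (Fin r) R) 0 0 (Matrix.fromBlocks a 0 0 1)) *
        Matrix.reindex e e (Matrix.fromBlocks (1 : Matrix (Fin r) (Fin r) R) 0 0 (Matrix.fromBlocks b 0 0 1)) =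
      Matrix.reindex e e (Matrix.fromBlocks (1 : Matrix (Fin r) (Fin r) R) 0 0 (Matrix.fromBlocks (a * b) 0 0 1)) := fun a b => by
    rw [Matrix.reindex_apply, Matrix.reindex_apply, Matrix.reindex_apply, Matrix.submatrix_mul_equiv, kernelBlock_mul]
  refine ⟨⟨Matrix.reindex e e (Matrix.fromBlocks (1 : Matrix (Fin r) (Fin r) R) 0 0 (Matrix.fromBlocks (g : Matrix (Fin m) (Fin m) R) 0 0 1)),
    Matrix.reindex e e (Matrix.fromBlocks (1 : Matrix (Fin r) (Fin r) R) 0 0 (Matrix.fromBlocks ((g⁻¹ : GL (Fin m) R) : Matrix (Fin m) (Fin m) R) 0 0 1)),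
    ?_, ?_⟩, rfl, ?_⟩
  · rw [hmul, ← Units.val_mul, mul_inv_cancel, Units.val_one, kernelBlock_one, Matrix.reindex_apply, Matrix.submatrix_one_equiv]
  · rw [hmul, ← Units.val_mul, inv_mul_cancel, Units.val_one, kernelBlock_one, Matrix.reindex_apply, Matrix.submatrix_one_equiv]
  · change (((Matrix.reindex e e (Matrix.fromBlocks (1 : Matrix (Fin r) (Fin r) R) 0 0 (Matrix.fromBlocks (g : Matrix (Fin m) (Fin m) R) 0 0 1))).map σ)ᵀ *
        wittFormOn e Han * Matrix.reindex e e (Matrix.fromBlocks (1 : Matrix (Fin r) (Fin r) R) 0 0 (Matrix.fromBlocks (g : Matrix (Fin m) (Fin m) R) 0 0 1))) =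
      wittFormOn e (formCongr σ g Han)
    rw [wittFormOn, wittFormOn, Matrix.reindex_apply, Matrix.reindex_apply, Matrix.reindex_apply, ← Matrix.submatrix_map, Matrix.transpose_submatrix,
      Matrix.submatrix_mul_equiv, Matrix.submatrix_mul_equiv, formCongr_kernelBlock_wittForm]

end Carrier

/-! ## §2 `U(σ, wittFormOn e Han) ≃ₜ* U(σ, wittFormOn e (σ(g)ᵀ Han g))` -/

section Transport

variable {K : Type*} [Field K] [TopologicalSpace K] [IsTopologicalRing K] (σ : K →+* K) {r m : ℕ} {n : Type*} [Fintype n] [DecidableEq n]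
  (e : WittIndex r m ≃ n)

/-- **KERNEL CONGRUENCE TRANSPORT, any `m`**: `U(σ, wittFormOn e Han) ≃ₜ* U(σ, wittFormOn e (formCongr σ g Han))` for every `g ∈ GL_m(K)` — conjugation by the
block-diagonal `T` of `exists_GL_formCongr_wittFormOn_eq` (★ `GLn.conjEquiv`, ★ `conj_mem_unitaryGroupOfForm_iff`).  The `m`-general twin of ★ p856319's
`nonempty_continuousMulEquiv_wittFormOn_kernel_one`. [cite: PlatonovRapinchuk1994, §2.3] [cite: Dieudonne1971GroupesClassiques, Chap. I §11] -/
theorem nonempty_continuousMulEquiv_wittFormOn_kernelCongr (g : GL (Fin m) K) (Han : Matrix (Fin m) (Fin m) K) :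
    Nonempty (↥(unitaryGroupOfForm σ (wittFormOn e Han)) ≃ₜ* ↥(unitaryGroupOfForm σ (wittFormOn e (formCongr σ g Han)))) := by
  obtain ⟨T, -, hT⟩ := exists_GL_formCongr_wittFormOn_eq σ e g Han
  exact ⟨(ContinuousMulEquiv.restrictSubgroup (GLn.conjEquiv T) (unitaryGroupOfForm σ (wittFormOn e (formCongr σ g Han))) (unitaryGroupOfForm σ (wittFormOn e Han))
    fun x => by rw [GLn.conjEquiv_apply, conj_mem_unitaryGroupOfForm_iff, hT]).symm⟩

end Transport

/-! ## §3 Every Witt model may be given a NORMALISED kernel; then `U = P_S · K₀` -/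

section Normalised

variable {K : Type*} [Field K] [Valued K ℤᵐ⁰] (σ : K →+* K) {N r m : ℕ} (e : WittIndex r m ≃ Fin N)

omit [Valued K ℤᵐ⁰] in
/-- Entries are values on basis vectors: `Han u u′ = h_an(e_u, e_{u′})`, so an `𝒪`-valued form has integral entries. [cite: Omeara1963, §82F] -/
theorem v_apply_le_one_of_forall_mem_stdLattice [Valued K ℤᵐ⁰] {Han : Matrix (Fin m) (Fin m) K}
    (h : ∀ x ∈ stdLattice K m, ∀ y ∈ stdLattice K m, Valued.v (hermForm σ Han x y) ≤ 1) (u u' : Fin m) : Valued.v (Han u u') ≤ 1 := by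
  rw [← hermForm_single_single σ Han u u']
  exact h _ (single_mem_stdLattice u) _ (single_mem_stdLattice u')

/-- **KERNEL NORMALISATION, ANY `m`.**  `K` with `Valued K ℤᵐ⁰`, compact principal valuation ring, a uniformiser `ϖ`; `σ` an involution preserving `v` with the
(norm) property `hnorm` (unramified and tamely ramified quadratic `K ∕ K^σ`).  Every `σ`-hermitian ANISOTROPIC kernel `Han ∈ M_m(K)` has a replacement `Han′ =
σ(g)ᵀ Han g` which is hermitian, anisotropic, INTEGRAL (`|Han′ u u′| ≤ 1`) and NORMALISED (`|h′(z,z)| ≤ 1 → z ∈ 𝒪^m`: the maximal lattice is `𝒪^m`), with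
`U(σ, wittFormOn e Han) ≃ₜ* U(σ, wittFormOn e Han′)` — ★ p856519 `exists_formCongr_maximalLattice_eq_stdLattice` ∘ §2.  So 13a at a place of Witt type `(r, m)`
may be proved in a model with normalised kernel, where ★ F3 `K2E3WittIwasawa` gives `U = P_S · K₀`, `K₀ = U ∩ GL_N(𝒪)`.
[cite: Omeara1963, §91A Thm. 91:1] [cite: Jacobowitz1962, §4] [cite: PlatonovRapinchuk1994, §2.3] [cite: BruhatTits1972, (4.4.3)] -/
theorem exists_wittKernel_maximalLattice_normalised [CompactSpace 𝒪[K]] [IsPrincipalIdealRing 𝒪[K]] {ϖ : K}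
    (hϖ : Valued.v ϖ = WithZero.exp (-1 : ℤ)) (hσ : ∀ a, σ (σ a) = a) (hvσ : ∀ a, Valued.v (σ a) = Valued.v a)
    (hnorm : ∀ u : K, σ u = u → Valued.v (u - 1) < 1 → ∃ z : K, z * σ z = u ∧ Valued.v (z - 1) ≤ Valued.v (u - 1))
    (Han : Matrix (Fin m) (Fin m) K) (hHan : (Han.map σ)ᵀ = Han) (han : ∀ z : Fin m → K, hermForm σ Han z z = 0 → z = 0) :
    ∃ Han' : Matrix (Fin m) (Fin m) K, (Han'.map σ)ᵀ = Han' ∧ (∀ z : Fin m → K, hermForm σ Han' z z = 0 → z = 0) ∧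
      (∀ u u', Valued.v (Han' u u') ≤ 1) ∧ (∀ z : Fin m → K, Valued.v (hermForm σ Han' z z) ≤ 1 → z ∈ stdLattice K m) ∧
      Nonempty (↥(unitaryGroupOfForm σ (wittFormOn e Han)) ≃ₜ* ↥(unitaryGroupOfForm σ (wittFormOn e Han'))) := by
  obtain ⟨g, hherm, han', hmax, hint⟩ := exists_formCongr_maximalLattice_eq_stdLattice (H := Han) hϖ hσ hvσ hnorm hHan han
  exact ⟨formCongr σ g Han, hherm, han', v_apply_le_one_of_forall_mem_stdLattice σ hint, fun z hz => (hmax z).1 hz,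
    nonempty_continuousMulEquiv_wittFormOn_kernelCongr σ e g Han⟩

/-- **KERNEL NORMALISATION WITH THE IWASAWA DECOMPOSITION ATTACHED**: as `exists_wittKernel_maximalLattice_normalised`, plus ★ F3
`exists_wittParabolic_mul_mem_unitaryInt` for the normalised model in a STANDARD indexing `e`: `U(σ, wittFormOn e Han′) = P_S · K₀` for every `S` (the `hGC`
binder of the Jacquet–Casselman driver with `C S = unitaryInt σ (wittFormOn e Han′)`, compact by ★ `isCompact_unitaryInt_of_forall_v_eq`).
[cite: BruhatTits1972, (4.4.3)] [cite: Omeara1963, §91A Thm. 91:1] [cite: PlatonovRapinchuk1994, §2.3] -/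
theorem exists_wittKernel_normalised_hGC [CompactSpace 𝒪[K]] [IsPrincipalIdealRing 𝒪[K]] {ϖ : K}
    (hϖ : Valued.v ϖ = WithZero.exp (-1 : ℤ)) (hσ : ∀ a, σ (σ a) = a) (hvσ : ∀ a, Valued.v (σ a) = Valued.v a)
    (hnorm : ∀ u : K, σ u = u → Valued.v (u - 1) < 1 → ∃ z : K, z * σ z = u ∧ Valued.v (z - 1) ≤ Valued.v (u - 1))
    (hstd : ∀ x, (e x).val = Sum.elim (fun i : Fin r => i.val) (Sum.elim (fun u : Fin m => r + u.val) (fun j : Fin r => r + m + j.val)) x)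
    (Han : Matrix (Fin m) (Fin m) K) (hHan : (Han.map σ)ᵀ = Han) (han : ∀ z : Fin m → K, hermForm σ Han z z = 0 → z = 0) :
    ∃ Han' : Matrix (Fin m) (Fin m) K, (Han'.map σ)ᵀ = Han' ∧ (∀ z : Fin m → K, hermForm σ Han' z z = 0 → z = 0) ∧
      (∀ u u', Valued.v (Han' u u') ≤ 1) ∧ (∀ z : Fin m → K, Valued.v (hermForm σ Han' z z) ≤ 1 → z ∈ stdLattice K m) ∧
      Nonempty (↥(unitaryGroupOfForm σ (wittFormOn e Han)) ≃ₜ* ↥(unitaryGroupOfForm σ (wittFormOn e Han'))) ∧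
      ∀ (S : Finset (Fin r)) (g : unitaryGroupOfForm σ (wittFormOn e Han')),
        ∃ p : ↥(standardParabolicTriple σ e Han' S).P, ∃ c ∈ (unitaryInt σ (wittFormOn e Han') : Set ↥(unitaryGroupOfForm σ (wittFormOn e Han'))),
          g = (p : ↥(unitaryGroupOfForm σ (wittFormOn e Han'))) * c := by
  obtain ⟨Han', hherm, han', hint, hmax, hiso⟩ := exists_wittKernel_maximalLattice_normalised σ e hϖ hσ hvσ hnorm Han hHan han
  exact ⟨Han', hherm, han', hint, hmax, hiso, fun S g => exists_wittParabolic_mul_mem_unitaryInt σ e Han' hσ hvσ hϖ hstd hherm hint hmax S g⟩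

end Normalised

end Summit.HodgeConjecture.HodgeConjecture.Cruxes.H413.K2E3WittKernelCongrTransport

end
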